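import Summits.AtomisticToContinuum.BoseEinsteinCondensation.Theorems.BECInsertionCorrectorCorrectorClosureHoleKLS
import Summits.AtomisticToContinuum.BoseEinsteinCondensation.Theorems.BECInsertionCorrectorCorrectorClosureRemovalEnergyBudgetRemoval
import Literature.MathematicalPhysics.QuantumManyBody.PeriodicTorusCalculus
import Literature.MathematicalPhysics.QuantumManyBody.PeriodicBoseGasFourier
import HarnessLib

/-!
# Calculus for the weak hole-mode equation (line `insertion-mode-gaussian-domination`, aux of
# `holeMode_weakEquation`, crux `BECInsertionCorrector.CorrectorClosure`, item stmt-AtomisticToContinuum-12058)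

Supports (does not close) stmt-AtomisticToContinuum-12058. Toolkit for the exact weak hole-mode equation of the
FK ground-state pair (`…HoleModeEquation.lean`): the real plane-wave modes `m_w(x) = Re(w conj φ_n(x))` (cosine and
sine quadratures for `w = c, -ic`), smooth, periodic, with `∂ⱼ m_w = m_{-w(2πi nⱼ/L)}` and the eigen-equation
`∑ⱼ ∂ⱼ² m_w = -|2πn/L|² m_w`; calculus on `(ℝ³)^{N+1} = ℝ³ × (ℝ³)^N` for test functions `g(z₀)ψ(tail Z)` (partial
derivatives, periodicity, the split of `∇Φ·∇(g ⊗ ψ)` into tagged and bath blocks) and **integration by parts in the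
tagged coordinate** `∫ ∂_{0,k}Φ · g(z₀)ψ(tail) = -∫ Φ · ∂ₖg(z₀)ψ(tail)` (`integral_cellN_pderiv_eq_zero`); Fubini with
the bath coordinates outermost (`reb_setIntegral_cellN_succ_right`); integrability of the insertion potential `W(x, Y) = ∑ⱼ v^per(x - yⱼ)` (bounded
periodisation); and the dictionary `Re(w ∫ conj φ_n G) = ∫ m_w G` identifying the real/imaginary parts of the hole
states `a(φ_n)Φ₀`, `a(φ_n)(WΦ₀)` and of the bath derivatives `∂_{j,k} a(φ_n)Φ₀` (`WF.fderiv_modeAn_single`) with real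
mode integrals.
-/

noncomputable section

open MeasureTheory Filter Matrix
open scoped ENNReal NNReal BigOperators ComplexConjugate

namespace Summit.AtomisticToContinuum.BoseEinsteinCondensation.Theorems.CorrectorClosure.InsertionModeGaussianDomination

open Literature.MathematicalPhysics.QuantumManyBody.BoseGas
open Summit.AtomisticToContinuum.BoseEinsteinCondensation.Theorems.CorrectorClosure.GeometricMeanCorrector
open Summit.AtomisticToContinuum.BoseEinsteinCondensation.Cruxes.PeriodicIRBound.LinearPhFloorWagner.WF
open Summit.AtomisticToContinuum.BoseEinsteinCondensation.Theorems.CorrectorClosure.ZeroModeRemovalSusceptibility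
  (reb_setIntegral_cellN_succ_right)

variable {N : ℕ} {L : ℝ}

/-! ### Real plane-wave modes `m_w(x) = Re(w · conj φ_n(x))` (`w = c`: `c L^{-3/2} cos(p·x)`; `w = -ic`:
`-c L^{-3/2} sin(p·x)`; `p = 2πn/L`) -/

/-- `∂ⱼ φ_n = (2πi nⱼ/L) φ_n`. [folklore] -/
theorem fderiv_planeWaveMode_apply_single (L : ℝ) (n : Fin 3 → ℤ) (x : Space) (j : Fin 3) :
    fderiv ℝ (planeWaveMode L n) x (EuclideanSpace.single j 1) =
      (2 * Real.pi * Complex.I * (n j) / L) * planeWaveMode L n x := by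
  have hd : DifferentiableAt ℝ (cellWave L n) x := ((contDiff_cellWave L n).differentiable (by simp)) x
  rw [show planeWaveMode L n = fun y => ((Real.sqrt (L ^ 3))⁻¹ : ℂ) * cellWave L n y from funext (planeWaveMode_eq L n),
    (hd.hasFDerivAt.const_mul ((Real.sqrt (L ^ 3))⁻¹ : ℂ)).fderiv, _root_.smul_apply, fderiv_cellWave_apply_single,
    smul_eq_mul]
  ring

/-- `m_w = Re(w conj φ_n)` is smooth. [folklore] -/
theorem contDiff_modeRe (L : ℝ) (n : Fin 3 → ℤ) (w : ℂ) {k : ℕ∞} :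
    ContDiff ℝ k (fun x => (w * conj (planeWaveMode L n x)).re) :=
  Complex.reCLM.contDiff.comp (contDiff_const.mul
    (Complex.conjCLE.contDiff.comp ((contDiff_planeWaveMode L n).of_le (mod_cast le_top))))

/-- `m_w = Re(w conj φ_n)` is `Lℤ³`-periodic. [folklore] -/
theorem modeRe_periodic {L : ℝ} (hL : L ≠ 0) (n : Fin 3 → ℤ) (w : ℂ) (x : Space) (k : Fin 3) :
    (w * conj (planeWaveMode L n (x + EuclideanSpace.single k L))).re = (w * conj (planeWaveMode L n x)).re := by
  rw [planeWaveMode_periodic hL]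

/-- **Derivative of the real modes** `m_w = Re(w conj φ_n)`: `∂ⱼ m_w = m_{-w (2πi nⱼ/L)}`. [folklore] -/
theorem fderiv_modeRe_apply_single (L : ℝ) (n : Fin 3 → ℤ) (w : ℂ) (x : Space) (j : Fin 3) :
    fderiv ℝ (fun y => (w * conj (planeWaveMode L n y)).re) x (EuclideanSpace.single j 1) =
      (-(w * (2 * Real.pi * Complex.I * (n j) / L)) * conj (planeWaveMode L n x)).re := by
  have hpw := ((contDiff_planeWaveMode L n).differentiable (by simp) x).hasFDerivAt
  have hc : HasFDerivAt (fun y => conj (planeWaveMode L n y))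
      ((Complex.conjCLE : ℂ →L[ℝ] ℂ).comp (fderiv ℝ (planeWaveMode L n) x)) x :=
    (Complex.conjCLE : ℂ →L[ℝ] ℂ).hasFDerivAt.comp x hpw
  have hm : HasFDerivAt (fun y => (w * conj (planeWaveMode L n y)).re)
      (Complex.reCLM.comp (w • (Complex.conjCLE : ℂ →L[ℝ] ℂ).comp (fderiv ℝ (planeWaveMode L n) x))) x :=
    Complex.reCLM.hasFDerivAt.comp x (hc.const_mul w)
  have hconj : conj (2 * Real.pi * Complex.I * (n j) / L : ℂ) = -(2 * Real.pi * Complex.I * (n j) / L) := by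
    apply Complex.ext <;> simp [neg_div]
  rw [hm.fderiv, ContinuousLinearMap.comp_apply, _root_.smul_apply, ContinuousLinearMap.comp_apply,
    fderiv_planeWaveMode_apply_single]
  show (w • Complex.conjCLE ((2 * Real.pi * Complex.I * (n j) / L) * planeWaveMode L n x)).re = _
  rw [Complex.conjCLE_apply, map_mul, hconj, smul_eq_mul]
  congr 1
  ring

/-- `|2πn/L|² = ∑ⱼ (2πnⱼ/L)²`. [folklore] -/
theorem norm_latticeVec_sq (L : ℝ) (n : Fin 3 → ℤ) :
    ‖latticeVec (2 * Real.pi / L) n‖ ^ 2 = ∑ j : Fin 3, (2 * Real.pi * (n j) / L) ^ 2 := by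
  rw [latticeVec, EuclideanSpace.norm_sq_eq]
  refine Finset.sum_congr rfl fun j _ => ?_
  rw [PiLp.toLp_apply, Real.norm_eq_abs, sq_abs]
  ring

/-- **The real modes `m_w = Re(w conj φ_n)` are Laplace eigenfunctions**: `∑ⱼ ∂ⱼ∂ⱼ m_w = -|2πn/L|² m_w`. [folklore] -/
theorem laplacian_modeRe (L : ℝ) (n : Fin 3 → ℤ) (w : ℂ) (x : Space) :
    ∑ j : Fin 3, fderiv ℝ (fun y => fderiv ℝ (fun z => (w * conj (planeWaveMode L n z)).re) y
        (EuclideanSpace.single j 1)) x (EuclideanSpace.single j 1) =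
      -‖latticeVec (2 * Real.pi / L) n‖ ^ 2 * (w * conj (planeWaveMode L n x)).re := by
  rw [norm_latticeVec_sq, neg_mul, Finset.sum_mul, ← Finset.sum_neg_distrib]
  refine Finset.sum_congr rfl fun j _ => ?_
  rw [show (fun y => fderiv ℝ (fun z => (w * conj (planeWaveMode L n z)).re) y (EuclideanSpace.single j 1)) = _
    from funext fun y => fderiv_modeRe_apply_single L n w y j, fderiv_modeRe_apply_single]
  have h : -(-(w * (2 * Real.pi * Complex.I * (n j) / L)) * (2 * Real.pi * Complex.I * (n j) / L)) =
      ((-((2 * Real.pi * (n j) / L) ^ 2) : ℝ) : ℂ) * w := by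
    have hI : Complex.I * Complex.I = -1 := Complex.I_mul_I
    push_cast
    linear_combination (w * (2 * Real.pi * (n j) / L) ^ 2) * hI
  rw [h, mul_assoc, Complex.re_ofReal_mul]
  ring

/-- Chain rule through the tagged coordinate: `D(g ∘ eval₀)(Z) = Dg(z₀) ∘ proj₀`. [folklore] -/
theorem hasFDerivAt_comp_apply_zero {g : Space → ℝ} (hg : Differentiable ℝ g) (Z : Config (N + 1)) :
    HasFDerivAt (fun W : Config (N + 1) => g (W 0))
      ((fderiv ℝ g (Z 0)).comp (ContinuousLinearMap.proj (R := ℝ) (φ := fun _ : Fin (N + 1) => Space) 0)) Z :=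
  (hg (Z 0)).hasFDerivAt.comp Z (hasFDerivAt_apply (𝕜 := ℝ) (0 : Fin (N + 1)) Z)

/-- `∂_{0,k}(g ∘ eval₀)(Z) = ∂_k g(z₀)` and `∂_{j+1,k}(g ∘ eval₀) = 0`. [folklore] -/
theorem pderiv_comp_apply_zero {g : Space → ℝ} (hg : Differentiable ℝ g) (Z : Config (N + 1)) (k : Fin 3) :
    pderiv 0 k (fun W : Config (N + 1) => g (W 0)) Z = fderiv ℝ g (Z 0) (EuclideanSpace.single k 1) ∧
      ∀ j : Fin N, pderiv j.succ k (fun W : Config (N + 1) => g (W 0)) Z = 0 := by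
  simp only [pderiv, (hasFDerivAt_comp_apply_zero hg Z).fderiv, ContinuousLinearMap.comp_apply,
    ContinuousLinearMap.proj_apply, Pi.single_eq_same, true_and]
  intro j
  rw [Pi.single_eq_of_ne (Fin.succ_ne_zero j).symm, map_zero]

/-- `g(z₀) ψ(tail Z)` is lattice periodic for `Lℤ³`-periodic `g` and lattice-periodic `ψ`. [folklore] -/
theorem isLatticePeriodic_mode_mul_tail {g : Space → ℝ}
    (hg : ∀ (x : Space) (k : Fin 3), g (x + EuclideanSpace.single k L) = g x) {ψ : Config N → ℝ}
    (hψ : IsLatticePeriodic L ψ) : IsLatticePeriodic L (fun W : Config (N + 1) => g (W 0) * ψ (Fin.tail W)) := by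
  intro Z i k
  show g ((Z + Pi.single i (EuclideanSpace.single k L) : Config (N + 1)) 0) *
      ψ (Fin.tail Z + Fin.tail (Pi.single i (EuclideanSpace.single k L) : Config (N + 1))) = g (Z 0) * ψ (Fin.tail Z)
  rw [Pi.add_apply]
  rcases Fin.eq_zero_or_eq_succ i with rfl | ⟨j, rfl⟩
  · rw [Pi.single_eq_same, hg, tilt_tail_single_zero, add_zero]
  · rw [Pi.single_eq_of_ne (Fin.succ_ne_zero j).symm, add_zero, tilt_tail_single_succ, hψ]

/-- The derivative of an `Lℤ³`-periodic function is `Lℤ³`-periodic. [folklore] -/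
theorem fderiv_periodic_of_periodic {g : Space → ℝ}
    (hg : ∀ (x : Space) (k : Fin 3), g (x + EuclideanSpace.single k L) = g x) (v : Space) (x : Space)
    (k : Fin 3) : fderiv ℝ g (x + EuclideanSpace.single k L) v = fderiv ℝ g x v := by
  rw [← fderiv_comp_add_right, show (fun y => g (y + EuclideanSpace.single k L)) = g from funext fun y => hg y k]

/-- `∂_{0,k}(g(z₀) ψ(tail Z)) = ∂_k g(z₀) ψ(tail Z)` and `∂_{j+1,k}(g(z₀) ψ(tail Z)) = g(z₀) ∂_{j,k}ψ(tail Z)`.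
[folklore] -/
theorem pderiv_mode_mul_tail {g : Space → ℝ} (hg : Differentiable ℝ g) {ψ : Config N → ℝ}
    (hψ : Differentiable ℝ ψ) (Z : Config (N + 1)) (k : Fin 3) :
    pderiv 0 k (fun W : Config (N + 1) => g (W 0) * ψ (Fin.tail W)) Z =
        fderiv ℝ g (Z 0) (EuclideanSpace.single k 1) * ψ (Fin.tail Z) ∧
      ∀ j : Fin N, pderiv j.succ k (fun W : Config (N + 1) => g (W 0) * ψ (Fin.tail W)) Z =
        g (Z 0) * pderiv j k ψ (Fin.tail Z) := by
  have hprod := fun i => pderiv_fun_mul (hasFDerivAt_comp_apply_zero hg Z).differentiableAt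
    (tilt_hasFDerivAt_comp_tail (hψ _)).differentiableAt i k
  refine ⟨?_, fun j => ?_⟩
  · rw [hprod, tilt_pderiv_comp_tail_zero hψ, (pderiv_comp_apply_zero hg Z k).1]
    ring
  · rw [hprod, tilt_pderiv_comp_tail_succ hψ, (pderiv_comp_apply_zero hg Z k).2 j, mul_zero, add_zero]

/-- **`Γ(Φ, g ⊗ ψ)` splits into the tagged block and the bath block**:
`∇Φ·∇(g(z₀)ψ(tail)) = ∑ₖ ∂_{0,k}Φ ∂ₖg(z₀) ψ(tail) + g(z₀) ∑ⱼₖ ∂_{j+1,k}Φ ∂_{j,k}ψ(tail)`. [folklore] -/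
theorem gradDot_mode_mul_tail (Φ : Config (N + 1) → ℝ) {g : Space → ℝ} (hg : Differentiable ℝ g)
    {ψ : Config N → ℝ} (hψ : Differentiable ℝ ψ) (Z : Config (N + 1)) :
    gradDot Φ (fun W : Config (N + 1) => g (W 0) * ψ (Fin.tail W)) Z =
      (∑ k : Fin 3, pderiv 0 k Φ Z * (fderiv ℝ g (Z 0) (EuclideanSpace.single k 1) * ψ (Fin.tail Z))) +
        g (Z 0) * ∑ j : Fin N, ∑ k : Fin 3, pderiv j.succ k Φ Z * pderiv j k ψ (Fin.tail Z) := by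
  rw [gradDot, Fin.sum_univ_succ]
  simp only [(pderiv_mode_mul_tail hg hψ Z _).1, (pderiv_mode_mul_tail hg hψ Z _).2, Finset.mul_sum]
  congr 1
  refine Finset.sum_congr rfl fun j _ => Finset.sum_congr rfl fun k _ => ?_
  ring

/-- **Integration by parts in the tagged coordinate** on `[0,L)^{3(N+1)}`: for `C¹` lattice-periodic `Φ`, `ψ` and a
`C¹` `Lℤ³`-periodic `g`, `∫ ∂_{0,k}Φ · g(z₀)ψ(tail) = -∫ Φ · ∂ₖg(z₀)ψ(tail)` (the cell integral of `∂_{0,k}` of the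
periodic flux `Φ g(z₀) ψ(tail)` vanishes, `integral_cellN_pderiv_eq_zero`).
[cite: BakryGentilLedoux2014, §1.11.3 (integration by parts behind (1.11.9))] -/
theorem integral_pderiv_zero_mul_mode_tail {N : ℕ} {L : ℝ} (hL : 0 < L) {Φ : Config (N + 1) → ℝ} (hΦ : ContDiff ℝ 1 Φ)
    (hΦper : IsLatticePeriodic L Φ) {g : Space → ℝ} (hg : ContDiff ℝ 1 g)
    (hgper : ∀ (x : Space) (k : Fin 3), g (x + EuclideanSpace.single k L) = g x)
    {ψ : Config N → ℝ} (hψ : ContDiff ℝ 1 ψ) (hψper : IsLatticePeriodic L ψ) (k : Fin 3) :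
    ∫ Z in cellN (N + 1) L, pderiv 0 k Φ Z * (g (Z 0) * ψ (Fin.tail Z)) =
      -∫ Z in cellN (N + 1) L, Φ Z * (fderiv ℝ g (Z 0) (EuclideanSpace.single k 1) * ψ (Fin.tail Z)) := by
  have hgd : Differentiable ℝ g := hg.differentiable one_ne_zero
  have hψd : Differentiable ℝ ψ := hψ.differentiable one_ne_zero
  have hηC : ContDiff ℝ 1 (fun W : Config (N + 1) => g (W 0) * ψ (Fin.tail W)) :=
    (hg.comp (contDiff_apply ℝ Space 0)).mul (tilt_contDiff_comp_tail hψ)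
  have hFC : ContDiff ℝ 1 (fun W : Config (N + 1) => Φ W * (g (W 0) * ψ (Fin.tail W))) := hΦ.mul hηC
  have hFper : IsLatticePeriodic L (fun W : Config (N + 1) => Φ W * (g (W 0) * ψ (Fin.tail W))) :=
    fun Z i c => congrArg₂ (· * ·) (hΦper Z i c) (isLatticePeriodic_mode_mul_tail hgper hψper Z i c)
  have h0 := integral_cellN_pderiv_eq_zero hL hFC hFper 0 k
  have hpt : ∀ Z, pderiv 0 k (fun W : Config (N + 1) => Φ W * (g (W 0) * ψ (Fin.tail W))) Z =
      pderiv 0 k Φ Z * (g (Z 0) * ψ (Fin.tail Z)) +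
        Φ Z * (fderiv ℝ g (Z 0) (EuclideanSpace.single k 1) * ψ (Fin.tail Z)) := by
    intro Z
    rw [pderiv_fun_mul ((hΦ.differentiable one_ne_zero) Z) ((hηC.differentiable one_ne_zero) Z),
      (pderiv_mode_mul_tail hgd hψd Z k).1]
    ring
  simp_rw [hpt] at h0
  have hdg : Continuous fun x => fderiv ℝ g x (EuclideanSpace.single k 1) :=
    (hg.continuous_fderiv one_ne_zero).clm_apply continuous_const
  have i1 : IntegrableOn (fun Z : Config (N + 1) => pderiv 0 k Φ Z * (g (Z 0) * ψ (Fin.tail Z))) (cellN (N + 1) L) :=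
    integrableOn_cellN ((continuous_pderiv hΦ 0 k).mul hηC.continuous) L
  have i2 : IntegrableOn (fun Z : Config (N + 1) =>
      Φ Z * (fderiv ℝ g (Z 0) (EuclideanSpace.single k 1) * ψ (Fin.tail Z))) (cellN (N + 1) L) :=
    integrableOn_cellN (hΦ.continuous.mul ((hdg.comp (continuous_apply 0)).mul
      (tilt_contDiff_comp_tail hψ).continuous)) L
  rw [integral_add i1 i2] at h0
  linarith

/-- Fubini for `G(Z) = g(Z) h(tail Z)`, bath coordinates outermost (`reb_setIntegral_cellN_succ_right`):
`∫_{[0,L)^{3(N+1)}} g h(tail) = ∫_Y h(Y) ∫_x g(x, Y)`. [folklore] -/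
theorem setIntegral_cellN_mul_tail {g : Config (N + 1) → ℝ} {h : Config N → ℝ}
    (hG : IntegrableOn (fun Z => g Z * h (Fin.tail Z)) (cellN (N + 1) L)) :
    ∫ Z in cellN (N + 1) L, g Z * h (Fin.tail Z) =
      ∫ Y in cellN N L, h Y * ∫ x in cell L, g (Matrix.vecCons x Y) := by
  rw [reb_setIntegral_cellN_succ_right hG]
  refine integral_congr_ae (ae_of_all _ fun Y => ?_)
  show ∫ x in cell L, g (Matrix.vecCons x Y) * h (Fin.tail (Matrix.vecCons x Y : Config (N + 1))) = _
  simp only [mixedLaw_tail_vecCons]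
  rw [integral_mul_const, mul_comm]

section Potential

variable {v : ℝ → ℝ≥0∞} {C : ℝ≥0}

/-- `0 ≤ ∑ⱼ v^per(x - yⱼ) ≤ N C` in `ℝ` for a bounded periodisation. [folklore] -/
theorem norm_sumPotential_le (hC : ∀ x, periodizedPotential v L x ≤ C) (x : Space) (Y : Config N) :
    ‖∑ j : Fin N, (periodizedPotential v L (x - Y j)).toReal‖ ≤ N * C := by
  have hle : ∀ y, (periodizedPotential v L y).toReal ≤ C := fun y => by
    simpa only [ENNReal.coe_toReal] using ENNReal.toReal_mono ENNReal.coe_ne_top (hC y)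
  rw [Real.norm_eq_abs, abs_of_nonneg (Finset.sum_nonneg fun j _ => ENNReal.toReal_nonneg)]
  exact (Finset.sum_le_sum fun j _ => hle (x - Y j)).trans (by simp)

/-- `W(·, Y) G` is integrable on the cell for continuous `G`. [folklore] -/
theorem integrableOn_sumPotential_mul_cell (hv : Measurable v) (hC : ∀ x, periodizedPotential v L x ≤ C)
    (Y : Config N) {G : Space → ℝ} (hG : Continuous G) :
    IntegrableOn (fun x => (∑ j : Fin N, (periodizedPotential v L (x - Y j)).toReal) * G x) (cell L) :=
  Integrable.bdd_mul (c := N * C) (integrableOn_cell hG)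
    (Finset.measurable_sum _ fun j _ => ((measurable_periodizedPotential hv L).comp
      (measurable_id.sub (measurable_const (a := Y j)))).ennreal_toReal).aestronglyMeasurable
    (ae_of_all _ fun x => norm_sumPotential_le hC x Y)

/-- `W G` is integrable on `[0,L)^{3(N+1)}` for continuous `G`. [folklore] -/
theorem integrableOn_sumPotential_mul_config (hv : Measurable v) (hC : ∀ x, periodizedPotential v L x ≤ C)
    {G : Config (N + 1) → ℝ} (hG : Continuous G) :
    IntegrableOn (fun Z : Config (N + 1) =>
      (∑ j : Fin N, (periodizedPotential v L (Z 0 - Z j.succ)).toReal) * G Z) (cellN (N + 1) L) :=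
  Integrable.bdd_mul (c := N * C) (integrableOn_cellN hG L)
    (Finset.measurable_sum _ fun j _ => ((measurable_periodizedPotential hv L).comp
      ((measurable_pi_apply 0).sub (measurable_pi_apply j.succ))).ennreal_toReal).aestronglyMeasurable
    (ae_of_all _ fun Z => norm_sumPotential_le hC (Z 0) (fun j => Z j.succ))

/-- `V_N(tail Z) G` is integrable on `[0,L)^{3(N+1)}` for continuous `G`. [folklore] -/
theorem integrableOn_tailInteraction_mul (hv : Measurable v) (hC : ∀ x, periodizedPotential v L x ≤ C)
    {G : Config (N + 1) → ℝ} (hG : Continuous G) :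
    IntegrableOn (fun Z : Config (N + 1) => (periodicInteraction v L (Fin.tail Z)).toReal * G Z)
      (cellN (N + 1) L) := by
  -- adapted from `tilt_el_tail` (TiltCorrectorLift)
  have hUbd : ∀ Y : Config N, ‖(periodicInteraction v L Y).toReal‖ ≤ ((N * N : ℕ) : ℝ) * C := fun Y => by
    rw [Real.norm_eq_abs, abs_of_nonneg ENNReal.toReal_nonneg]
    have h := ENNReal.toReal_mono (ENNReal.mul_ne_top (ENNReal.natCast_ne_top _) ENNReal.coe_ne_top)
      (periodicInteraction_le_of_bounded hC Y)
    rwa [ENNReal.toReal_mul, ENNReal.toReal_natCast, ENNReal.coe_toReal] at h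
  refine Integrable.bdd_mul (c := ((N * N : ℕ) : ℝ) * C) (integrableOn_cellN hG L) ?_ (ae_of_all _ fun Z => hUbd _)
  exact ((measurable_periodicInteraction_wf hv L).ennreal_toReal.comp
    (measurable_pi_lambda _ fun j => measurable_pi_apply (Fin.succ j))).aestronglyMeasurable

/-- **Real part of a mode integral of a real function**: `Re(w ∫_cell conj(φ_n) G) = ∫_cell m_w G` for a real
`G` integrable on the cell. [folklore] -/
theorem re_mul_integral_conj_planeWaveMode (n : Fin 3 → ℤ) (w : ℂ) {G : Space → ℝ}
    (hG : IntegrableOn G (cell L)) :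
    (w * ∫ x in cell L, conj (planeWaveMode L n x) * (G x : ℂ)).re =
      ∫ x in cell L, (w * conj (planeWaveMode L n x)).re * G x := by
  have hint : Integrable (fun x => conj (planeWaveMode L n x) * (G x : ℂ)) (volume.restrict (cell L)) :=
    Integrable.bdd_mul (c := (Real.sqrt (L ^ 3))⁻¹) hG.ofReal
      (Complex.continuous_conj.comp (continuous_planeWaveMode L n)).aestronglyMeasurable
      (ae_of_all _ fun x => by rw [Complex.norm_conj, norm_planeWaveMode])
  rw [← integral_const_mul]
  have h := integral_re (hint.const_mul w)
  simp only [RCLike.re_to_complex] at h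
  rw [← h]
  refine integral_congr_ae (ae_of_all _ fun x => ?_)
  show (w * (conj (planeWaveMode L n x) * (G x : ℂ))).re = (w * conj (planeWaveMode L n x)).re * G x
  rw [← mul_assoc, Complex.re_mul_ofReal]

/-- `Im z = Re(-i z)`. [folklore] -/
theorem im_eq_re_neg_I_mul (z : ℂ) : z.im = (-Complex.I * z).re := by
  simp [Complex.mul_re]

variable {Φ₀ : Config (N + 1) → ℝ}

/-- **Real and imaginary parts of the hole state**: `Re (a(φ_n)Φ₀)(Y) = ∫_cell m_{√(N+1)}(x) Φ₀(x, Y) dx`,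
`Im (a(φ_n)Φ₀)(Y) = ∫_cell m_{-i√(N+1)}(x) Φ₀(x, Y) dx`. [folklore] -/
theorem re_im_modeAn_ofReal (hΦ : Continuous Φ₀) (n : Fin 3 → ℤ) (Y : Config N) :
    (modeAn L (planeWaveMode L n) (fun X => (Φ₀ X : ℂ)) Y).re =
        ∫ x in cell L, ((Real.sqrt (N + 1) : ℂ) * conj (planeWaveMode L n x)).re * Φ₀ (Matrix.vecCons x Y) ∧
      (modeAn L (planeWaveMode L n) (fun X => (Φ₀ X : ℂ)) Y).im =
        ∫ x in cell L, (-Complex.I * (Real.sqrt (N + 1) : ℂ) * conj (planeWaveMode L n x)).re * Φ₀ (Matrix.vecCons x Y) := by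
  have hs : IntegrableOn (fun x => Φ₀ (Matrix.vecCons x Y)) (cell L) :=
    integrableOn_cell (hΦ.comp (continuous_id.matrixVecCons continuous_const))
  rw [im_eq_re_neg_I_mul, modeAn_apply, ← mul_assoc (-Complex.I)]
  exact ⟨re_mul_integral_conj_planeWaveMode n _ hs, re_mul_integral_conj_planeWaveMode n _ hs⟩

/-- `∂_{j,k} Re(w a(φ_n)Φ₀)(Y) = Re(w √(N+1) ∫ conj φ_n ∂_{j+1,k}Φ₀(·, Y))` (differentiation under the integral,
`WF.fderiv_modeAn_single`). [folklore] -/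
theorem pderiv_re_const_mul_modeAn (hΦ : ContDiff ℝ 1 Φ₀) (n : Fin 3 → ℤ) (w : ℂ) (Y : Config N) (j : Fin N)
    (k : Fin 3) :
    pderiv j k (fun Y => (w * modeAn L (planeWaveMode L n) (fun X => (Φ₀ X : ℂ)) Y).re) Y =
      (w * ((Real.sqrt (N + 1) : ℝ) : ℂ) * ∫ x in cell L, conj (planeWaveMode L n x) *
        ((pderiv j.succ k Φ₀ (Matrix.vecCons x Y) : ℝ) : ℂ)).re := by
  have hΦc : ContDiff ℝ 1 fun X => ((Φ₀ X : ℝ) : ℂ) := Complex.ofRealCLM.contDiff.comp hΦ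
  have hd := differentiable_modeAn L (continuous_planeWaveMode L n) hΦc Y
  have h : HasFDerivAt (fun Y => (w * modeAn L (planeWaveMode L n) (fun X => (Φ₀ X : ℂ)) Y).re)
      (Complex.reCLM.comp (w • fderiv ℝ (modeAn L (planeWaveMode L n) (fun X => (Φ₀ X : ℂ))) Y)) Y :=
    Complex.reCLM.hasFDerivAt.comp Y (hd.hasFDerivAt.const_mul w)
  rw [pderiv, h.fderiv, ContinuousLinearMap.comp_apply, _root_.smul_apply,
    fderiv_modeAn_single L (continuous_planeWaveMode L n) hΦc Y j, Complex.reCLM_apply, smul_eq_mul, ← mul_assoc]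
  congr 2
  refine integral_congr_ae (ae_of_all _ fun x => ?_)
  show conj (planeWaveMode L n x) * fderiv ℝ (fun Z => ((Φ₀ Z : ℝ) : ℂ)) (Matrix.vecCons x Y)
      (Pi.single j.succ (EuclideanSpace.single k 1)) = _
  rw [fderiv_ofReal_apply ((hΦ.differentiable one_ne_zero) _)]
  rfl

/-- **Bath derivatives of `Re a(φ_n)Φ₀`, `Im a(φ_n)Φ₀`** (differentiation under the integral):
`∂_{j,k} Re(aΦ₀)(Y) = ∫_cell m_{√(N+1)} ∂_{j+1,k}Φ₀(·, Y)`, `∂_{j,k} Im(aΦ₀)(Y) = ∫_cell m_{-i√(N+1)} ∂_{j+1,k}Φ₀(·, Y)`.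
[folklore] -/
theorem pderiv_re_im_modeAn_ofReal (hΦ : ContDiff ℝ 1 Φ₀) (n : Fin 3 → ℤ) (Y : Config N) (j : Fin N) (k : Fin 3) :
    pderiv j k (fun Y => (modeAn L (planeWaveMode L n) (fun X => (Φ₀ X : ℂ)) Y).re) Y =
        ∫ x in cell L, ((Real.sqrt (N + 1) : ℂ) * conj (planeWaveMode L n x)).re * pderiv j.succ k Φ₀ (Matrix.vecCons x Y) ∧
      pderiv j k (fun Y => (modeAn L (planeWaveMode L n) (fun X => (Φ₀ X : ℂ)) Y).im) Y =
        ∫ x in cell L, (-Complex.I * (Real.sqrt (N + 1) : ℂ) * conj (planeWaveMode L n x)).re *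
          pderiv j.succ k Φ₀ (Matrix.vecCons x Y) := by
  have hs : IntegrableOn (fun x => pderiv j.succ k Φ₀ (Matrix.vecCons x Y)) (cell L) :=
    integrableOn_cell ((continuous_pderiv hΦ _ k).comp (continuous_id.matrixVecCons continuous_const))
  refine ⟨?_, ?_⟩
  · have h := pderiv_re_const_mul_modeAn (L := L) hΦ n 1 Y j k
    simp only [one_mul] at h
    rw [h]
    exact re_mul_integral_conj_planeWaveMode n _ hs
  · rw [show (fun Y => (modeAn L (planeWaveMode L n) (fun X => (Φ₀ X : ℂ)) Y).im) =
        fun Y => (-Complex.I * modeAn L (planeWaveMode L n) (fun X => (Φ₀ X : ℂ)) Y).re from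
      funext fun Y => im_eq_re_neg_I_mul _, pderiv_re_const_mul_modeAn hΦ n (-Complex.I) Y j k]
    exact re_mul_integral_conj_planeWaveMode n _ hs

/-- **Real and imaginary parts of the hole state of `W Φ₀`**:
`Re (a(φ_n)(WΦ₀))(Y) = ∫_cell m_{√(N+1)}(x) W(x, Y) Φ₀(x, Y) dx`, and the same with `Im`, `m_{-i√(N+1)}`.
[folklore] -/
theorem re_im_modeAn_sumPotential (hv : Measurable v) (hC : ∀ x, periodizedPotential v L x ≤ C)
    (hΦ : Continuous Φ₀) (n : Fin 3 → ℤ) (Y : Config N) :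
    ((modeAn L (planeWaveMode L n) (fun X : Config (N + 1) =>
        ((∑ j : Fin N, (periodizedPotential v L (X 0 - X j.succ)).toReal : ℝ) : ℂ) * ((Φ₀ X : ℝ) : ℂ)) Y).re =
      ∫ x in cell L, ((Real.sqrt (N + 1) : ℂ) * conj (planeWaveMode L n x)).re *
        ((∑ j : Fin N, (periodizedPotential v L (x - Y j)).toReal) * Φ₀ (Matrix.vecCons x Y))) ∧
    ((modeAn L (planeWaveMode L n) (fun X : Config (N + 1) =>
        ((∑ j : Fin N, (periodizedPotential v L (X 0 - X j.succ)).toReal : ℝ) : ℂ) * ((Φ₀ X : ℝ) : ℂ)) Y).im =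
      ∫ x in cell L, (-Complex.I * (Real.sqrt (N + 1) : ℂ) * conj (planeWaveMode L n x)).re *
        ((∑ j : Fin N, (periodizedPotential v L (x - Y j)).toReal) * Φ₀ (Matrix.vecCons x Y))) := by
  have hint := integrableOn_sumPotential_mul_cell hv hC Y (G := fun x => Φ₀ (Matrix.vecCons x Y))
    (hΦ.comp (continuous_id.matrixVecCons continuous_const))
  rw [im_eq_re_neg_I_mul, modeAn_apply, ← mul_assoc (-Complex.I)]
  simp only [Matrix.cons_val_zero, Matrix.cons_val_succ, ← Complex.ofReal_mul]
  exact ⟨re_mul_integral_conj_planeWaveMode n _ hint, re_mul_integral_conj_planeWaveMode n _ hint⟩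

/-- `Re(aΦ₀)`, `Im(aΦ₀)` are `C¹` and lattice periodic (`WF.contDiff_modeAn`, `WF.isTorusPeriodic_modeAn`).
[folklore] -/
theorem regular_re_im_modeAn (hΦ : ContDiff ℝ 1 Φ₀) (hΦper : IsLatticePeriodic L Φ₀) (n : Fin 3 → ℤ) :
    (ContDiff ℝ 1 (fun Y => (modeAn L (planeWaveMode L n) (fun X => (Φ₀ X : ℂ)) Y).re) ∧
      IsLatticePeriodic L (fun Y => (modeAn L (planeWaveMode L n) (fun X => (Φ₀ X : ℂ)) Y).re)) ∧
    (ContDiff ℝ 1 (fun Y => (modeAn L (planeWaveMode L n) (fun X => (Φ₀ X : ℂ)) Y).im) ∧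
      IsLatticePeriodic L (fun Y => (modeAn L (planeWaveMode L n) (fun X => (Φ₀ X : ℂ)) Y).im)) := by
  have h := contDiff_modeAn L (continuous_planeWaveMode L n) (Complex.ofRealCLM.contDiff.comp hΦ)
  have hp : IsTorusPeriodic L (modeAn L (planeWaveMode L n) (fun X => (Φ₀ X : ℂ))) :=
    isTorusPeriodic_modeAn L _ fun X i k => by
      show ((Φ₀ (X + _) : ℝ) : ℂ) = (Φ₀ X : ℂ)
      rw [hΦper X i k]
  exact ⟨⟨Complex.reCLM.contDiff.comp h, fun Y i k => by show (modeAn L _ _ (Y + _)).re = _; rw [hp Y i k]⟩,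
    ⟨Complex.imCLM.contDiff.comp h, fun Y i k => by show (modeAn L _ _ (Y + _)).im = _; rw [hp Y i k]⟩⟩

end Potential

end Summit.AtomisticToContinuum.BoseEinsteinCondensation.Theorems.CorrectorClosure.InsertionModeGaussianDomination

end
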